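import Summits.QuantumFields.BalabanUV.Beta.CombHId2W2Letters

/-!
# `BalabanUV.Beta.CombHId2W2Exchange` — binder row D1 (OWNER an2), (J-a) dictionary, (C2) at ORDER 2, part TWO-c (letters, continued): **`dper` COMMUTES WITH BOTH
# CHAIN-RULE VERTICES BY FUBINI ALONE; A VERTEX AT A PERIOD-TRANSLATED BOND IS THE VERTEX AT THE BOND OVER THE INDEX-SHIFTED FAMILY; `Σ'_n` PASSES INSIDE THE
# TABLE SLOT OF BOTH VERTICES** — the exchange letters for the words of `W2OfK` under the door's copy sum

WHY.  `W2OfK K N S M S₂ M₂ b b′ = vertex2OfK K N S₂ b b′ + mixOfK K N M₂ b b′ + mixOfK K N M₂ b′ b + dM (K2OfK K N S M b′) N S M b` (`SecondOrderResponse` :352): every word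
is one or two chain-rule vertices (`vertexOfK` ∕ `vertexOfM`) nested; under the door's copy sum `b′ ↦ b′ + M′∘n` the moving bond either sits in the OUTER column
(§5: re-index the slot) or in the INNER table (`CombHId2W2Slot`: the copies sum inside the slot), and the final `dper M` passes both vertices (§4).  All three are dominated
exchanges on the product majorants of `CombHId2W2Letters` §3 (`exp_half_triangle`).
WHAT ([folklore]; 0 `def`, 0 cited fact, 0 `def … : Prop`, 0 sorry): §4 `prodBound_dper_colH`, **`dper_vertexOfK'`**, `prodBound_dper_colM`, **`dper_vertexOfM'`**, **`dper_dM'`**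
(for ANY decaying `K` — no invariance, no covariance; contrast C2a∕C3a, which also give the torus reading), `dper_vertexOfK_of_biLocAt`, `dper_vertexOfM_of_biLocAt`
(the same for a first-order family localised at a MOVING centre `q κ u`, weight `g`); §5 `colH_translate_per`, `colM_translate_per`,
**`vertexOfK_translate_per`**, **`vertexOfM_translate_per`** (`K` fine-period invariant, `M = N·M′`; pure re-indexing).  (§6–§7 — `Σ'_n` inside the slot, far bounds —
are the sequel `CombHId2W2Slot`.)
NOT HERE: the words of `W2OfK` ∕ `W2SymOfK` (→ `CombHId2W2Words`), the door's `hId₂`; nothing of Bałaban's asserted; NOT D1, NEVER «G-an2-4 closed», NOT BetaPertH,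
NOT continuum, NOT Clay.

HONEST DEPENDENCY (page 1, mandatory): continuum YM on T⁴ ⇐ BetaPertH ∧ nine spine estimates (0/9 proved); BetaPertH ⇐ (D1) ∧ (D4) ∧ CAP+tail;
G-an2-4 gates asym, D1 and NE2/3/4.  HONEST FRAMING (cell contract, verbatim): «discharging `BetaPertH` makes Bałaban's UV stability UNCONDITIONAL —
a real constructive-QFT result; it is NOT the continuum limit and NOT the Clay problem.»  ABSOLUTE RULE (cell charter, verbatim): «No internally-minted
statement may enter as a cited fact. Every hypothesis is either kernel-proved in this package or a verbatim quotation of a PUBLISHED theorem with page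
reference. The manuscript(s) under audit are NOT citable for their own disputed steps — they are the thing under adjudication; programme-internal
(2001/route/tribunal) claims are never citable.»  Row D1 OWNER an2 (b2b-balaban-beta-an2) gen 44, 2026-08-23; over `CombHId2W2Letters`, C2a∕C3a, `KernelWard` BY NAME.
-/

noncomputable section

open scoped BigOperators

namespace Summit.QuantumFields.BalabanUV.Beta.CombHId2W2Exchange

open Literature.MathematicalPhysics.QuantumFieldTheory.Balaban1983to89
open Literature.MathematicalPhysics.QuantumFieldTheory.Balaban1983to89.Beta
open B12Sec2to5 (l1 l1_nonneg)
open B4TorusKernel.MultiPeriod (translate translate_apply)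
open ExpKernelCalculus (MKer Decays BiLoc VertexFamily comp shiftK summable_exp_shift summable_exp_shift' l1_sub_triangle l1_sub_symm)
open AffineAveraging (Site)
open OneStepResolventKernel (Fib)
open OneStepKernelFamily (vertexOfK)
open SecondOrderResponse (colM vertexOfM dM dM_apply)
open InterLevelTransport (cwsum cwsum_apply)
open KernelWard (ProdBound tsum_comm_of_prodBound)
open BalabanStepJetsSucc (l1_sub_le_l1_smul_sub)
open Summit.QuantumFields.BalabanUV.Beta.FP.KernelPeriodisationFibLoc (dper dper_apply shiftK_eq_translate summable_exp_l1_translate)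
open Summit.QuantumFields.BalabanUV.Beta.CombHId1Letters (vertexOfK_apply)

open Summit.QuantumFields.BalabanUV.Beta.CombHId2W2Letters (exp_rate_mono exp_half_triangle abs_le_row_of_biLoc abs_le_of_decays summable_exp_l1_nsmul_sub
  summable_exp_l1_sub_nsmul)

variable {d : ℕ} (M : Fin (d + 1) → ℕ) [∀ μ, NeZero (M μ)] {N : ℕ} [NeZero N]

/-! ## §4 `dper` commutes with both vertices by Fubini alone (no invariance, no covariance) -/

section Fubini

variable {K : MKer (d + 1) (Fib d)} {CK δK : ℝ}

omit [NeZero N] in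
/-- [folklore] the `(m, u)` family behind `dper M (vertexOfK K N S μ y)` has a product majorant (half-triangle trick at the rate `min δK δS`). -/
theorem prodBound_dper_colH {S : Fin (d + 1) → Site (d + 1) → MKer (d + 1) (Fib d)} {CS δS : ℝ} (hK : Decays K CK δK) (hδK : 0 < δK)
    (hS : ∀ κ u, BiLoc (S κ u) u u CS δS) (hδS : 0 < δS) (μ κ : Fin (d + 1)) (y x z : Site (d + 1)) (a c : Fib d) :
    ProdBound fun m u => K u ((N : ℤ) • y) (Sum.inl κ) (Sum.inr μ) * S κ u (translate M x m) (translate M z m) a c := by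
  have hCK : 0 ≤ CK := hK.nonneg (Sum.inl 0)
  have hCS : 0 ≤ CS := (hS 0 0).nonneg (Sum.inl 0)
  set r : ℝ := min δK δS with hr
  have hr0 : 0 < r := lt_min hδK hδS
  refine ⟨fun m => Real.exp (-(r / 2) * l1 (translate M x m - (N : ℤ) • y)), fun u => CK * CS * Real.exp (-(r / 2) * l1 (u - (N : ℤ) • y)),
    (summable_exp_l1_translate M (half_pos hr0) ((N : ℤ) • y) x).1, (summable_exp_shift' (half_pos hr0) ((N : ℤ) • y)).mul_left _,
    fun m => (Real.exp_pos _).le, fun u => by positivity, fun m u => ?_⟩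
  rw [abs_mul]
  have h1 := abs_le_of_decays hK (min_le_left δK δS) u ((N : ℤ) • y) (Sum.inl κ) (Sum.inr μ)
  have h2 := abs_le_row_of_biLoc (hS κ u) (min_le_right δK δS) hr0.le (translate M x m) (translate M z m) a c
  calc |K u ((N : ℤ) • y) (Sum.inl κ) (Sum.inr μ)| * |S κ u (translate M x m) (translate M z m) a c|
      ≤ (CK * Real.exp (-r * l1 (u - (N : ℤ) • y))) * (CS * Real.exp (-r * l1 (translate M x m - u))) := mul_le_mul h1 h2 (abs_nonneg _) (by positivity)
    _ = CK * CS * (Real.exp (-r * l1 (u - (N : ℤ) • y)) * Real.exp (-r * l1 (translate M x m - u))) := by ring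
    _ ≤ CK * CS * (Real.exp (-(r / 2) * l1 (translate M x m - (N : ℤ) • y)) * Real.exp (-(r / 2) * l1 (u - (N : ℤ) • y))) :=
        mul_le_mul_of_nonneg_left (exp_half_triangle hr0.le _ _ _) (by positivity)
    _ = _ := by ring

omit [NeZero N] in
/-- [folklore] **`dper M (vertexOfK K N S μ y) = vertexOfK K N (dper M ∘ S) μ y` BY FUBINI** — `K` decaying, every `S κ u` bi-localised at `u`; no invariance of `K`,
no covariance of `S` (contrast C2a's `dper_vertexOfK`, which also delivers the torus reading). -/
theorem dper_vertexOfK' {S : Fin (d + 1) → Site (d + 1) → MKer (d + 1) (Fib d)} {CS δS : ℝ} (hK : Decays K CK δK) (hδK : 0 < δK)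
    (hS : ∀ κ u, BiLoc (S κ u) u u CS δS) (hδS : 0 < δS) (μ : Fin (d + 1)) (y : Site (d + 1)) :
    dper M (vertexOfK K N S μ y) = vertexOfK K N (fun κ u => dper M (S κ u)) μ y := by
  funext x z a c
  have hPB := fun κ => prodBound_dper_colH M (N := N) hK hδK hS hδS μ κ y x z a c
  simp only [dper_apply, vertexOfK_apply]
  rw [Summable.tsum_finsetSum (fun κ _ => ?_)]
  · refine Finset.sum_congr rfl fun κ _ => ?_
    rw [tsum_comm_of_prodBound (hPB κ)]
    refine tsum_congr fun u => ?_
    rw [tsum_mul_left]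
  · obtain ⟨h0, -, -⟩ := (hPB κ).summable
    exact h0.prod

/-- [folklore] the `(m, w)` family behind `dper M (vertexOfM K N Mt μ y)` has a product majorant. -/
theorem prodBound_dper_colM {Mt : Fin (d + 1) → Site (d + 1) → MKer (d + 1) (Fib d)} {CM δM : ℝ} (hK : Decays K CK δK) (hδK : 0 < δK)
    (hMt : VertexFamily Mt N CM δM) (hδM : 0 < δM) (μ ρ : Fin (d + 1)) (y x z : Site (d + 1)) (a c : Fib d) :
    ProdBound fun m w => K ((N : ℤ) • w) ((N : ℤ) • y) (Sum.inr ρ) (Sum.inr μ) * Mt ρ w (translate M x m) (translate M z m) a c := by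
  have hCK : 0 ≤ CK := hK.nonneg (Sum.inl 0)
  have hCM : 0 ≤ CM := (hMt 0 0).nonneg (Sum.inl 0)
  have hN : 1 ≤ N := Nat.one_le_iff_ne_zero.mpr (NeZero.ne N)
  set r : ℝ := min δK δM with hr
  have hr0 : 0 < r := lt_min hδK hδM
  refine ⟨fun m => Real.exp (-(r / 2) * l1 (translate M x m - (N : ℤ) • y)), fun w => CK * CM * Real.exp (-(r / 2) * l1 ((N : ℤ) • w - (N : ℤ) • y)),
    (summable_exp_l1_translate M (half_pos hr0) ((N : ℤ) • y) x).1, (summable_exp_l1_nsmul_sub (N := N) hN (half_pos hr0) ((N : ℤ) • y)).mul_left _,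
    fun m => (Real.exp_pos _).le, fun w => by positivity, fun m w => ?_⟩
  rw [abs_mul]
  have h1 := abs_le_of_decays hK (min_le_left δK δM) ((N : ℤ) • w) ((N : ℤ) • y) (Sum.inr ρ) (Sum.inr μ)
  have h2 := abs_le_row_of_biLoc (hMt ρ w) (min_le_right δK δM) hr0.le (translate M x m) (translate M z m) a c
  calc |K ((N : ℤ) • w) ((N : ℤ) • y) (Sum.inr ρ) (Sum.inr μ)| * |Mt ρ w (translate M x m) (translate M z m) a c|
      ≤ (CK * Real.exp (-r * l1 ((N : ℤ) • w - (N : ℤ) • y))) * (CM * Real.exp (-r * l1 (translate M x m - (N : ℤ) • w))) :=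
        mul_le_mul h1 h2 (abs_nonneg _) (by positivity)
    _ = CK * CM * (Real.exp (-r * l1 ((N : ℤ) • w - (N : ℤ) • y)) * Real.exp (-r * l1 (translate M x m - (N : ℤ) • w))) := by ring
    _ ≤ CK * CM * (Real.exp (-(r / 2) * l1 (translate M x m - (N : ℤ) • y)) * Real.exp (-(r / 2) * l1 ((N : ℤ) • w - (N : ℤ) • y))) :=
        mul_le_mul_of_nonneg_left (exp_half_triangle hr0.le _ _ _) (by positivity)
    _ = _ := by ring

/-- [folklore] **`dper M (vertexOfM K N Mt μ y) = vertexOfM K N (dper M ∘ Mt) μ y` BY FUBINI** (`K` decaying, `Mt` a vertex family). -/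
theorem dper_vertexOfM' {Mt : Fin (d + 1) → Site (d + 1) → MKer (d + 1) (Fib d)} {CM δM : ℝ} (hK : Decays K CK δK) (hδK : 0 < δK)
    (hMt : VertexFamily Mt N CM δM) (hδM : 0 < δM) (μ : Fin (d + 1)) (y : Site (d + 1)) :
    dper M (vertexOfM K N Mt μ y) = vertexOfM K N (fun ρ w => dper M (Mt ρ w)) μ y := by
  funext x z a c
  have hPB := fun ρ => prodBound_dper_colM M (N := N) hK hδK hMt hδM μ ρ y x z a c
  have e : ∀ (F : Fin (d + 1) → Site (d + 1) → MKer (d + 1) (Fib d)) (x z : Site (d + 1)),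
      vertexOfM K N F μ y x z a c = ∑ ρ, ∑' w, K ((N : ℤ) • w) ((N : ℤ) • y) (Sum.inr ρ) (Sum.inr μ) * F ρ w x z a c :=
    fun F x z => by simp only [vertexOfM, cwsum_apply, colM]
  simp only [dper_apply, e]
  rw [Summable.tsum_finsetSum (fun ρ _ => ?_)]
  · refine Finset.sum_congr rfl fun ρ _ => ?_
    rw [tsum_comm_of_prodBound (hPB ρ)]
    refine tsum_congr fun w => ?_
    rw [tsum_mul_left]
  · obtain ⟨h0, -, -⟩ := (hPB ρ).summable
    exact h0.prod

/-- [folklore] **`dper M (dM K N S Mt μ y) = dM K N (dper M ∘ S) (dper M ∘ Mt) μ y` BY FUBINI** — for ANY decaying `K` (e.g. a periodised derivative of the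
inverse, which is not a column of an invariant kernel). -/
theorem dper_dM' {S Mt : Fin (d + 1) → Site (d + 1) → MKer (d + 1) (Fib d)} {CS δS CM δM : ℝ} (hK : Decays K CK δK) (hδK : 0 < δK)
    (hS : ∀ κ u, BiLoc (S κ u) u u CS δS) (hδS : 0 < δS) (hMt : VertexFamily Mt N CM δM) (hδM : 0 < δM) (μ : Fin (d + 1)) (y : Site (d + 1)) :
    dper M (dM K N S Mt μ y) = dM K N (fun κ u => dper M (S κ u)) (fun ρ w => dper M (Mt ρ w)) μ y := by
  have hCK : 0 ≤ CK := hK.nonneg (Sum.inl 0)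
  have h1 := CombHId1Sandwich.biLoc_vertexOfK (N := N) hK hδK hS hδS μ y
  have hδ₀ : 0 < min δK δM := lt_min hδK hδM
  have h2 := SecondOrderResponse.vertexFamily_vertexOfM (N := N) hK hCK
    (BalabanStepW2.vertexFamily_mono' hMt ((hMt 0 0).nonneg (Sum.inl 0)) (min_le_right δK δM)) hδ₀ (min_le_left δK δM) μ y
  unfold dM
  rw [CombHId2Letters.dper_add_of_biLoc M h1 (half_pos (lt_min hδK hδS)) h2 (half_pos hδ₀), dper_vertexOfK' M hK hδK hS hδS μ y,
    dper_vertexOfM' M hK hδK hMt hδM μ y]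

omit [NeZero N] in
/-- [folklore] `dper M (vertexOfK K N T ν y′) = vertexOfK K N (dper M ∘ T) ν y′` for a table family localised at ONE COMMON point `q` (`BiLoc (T κ u) q q B δ` for all
`κ u` — the shape of a copy-summed two-bond table read in its second bond). -/
theorem dper_vertexOfK_of_biLocAt {T : Fin (d + 1) → Site (d + 1) → MKer (d + 1) (Fib d)} {q : Site (d + 1)} {B δ : ℝ} (hK : Decays K CK δK)
    (hδK : 0 < δK) (hT : ∀ κ u, BiLoc (T κ u) q q B δ) (hδ : 0 < δ) (ν : Fin (d + 1)) (y' : Site (d + 1)) :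
    dper M (vertexOfK K N T ν y') = vertexOfK K N (fun κ u => dper M (T κ u)) ν y' := by
  have hCK : 0 ≤ CK := hK.nonneg (Sum.inl 0)
  have hB : 0 ≤ B := (hT 0 0).nonneg (Sum.inl 0)
  funext x z a c
  have hPB : ∀ κ : Fin (d + 1), ProdBound fun m u => K u ((N : ℤ) • y') (Sum.inl κ) (Sum.inr ν) * T κ u (translate M x m) (translate M z m) a c := by
    intro κ
    refine ⟨fun m => B * Real.exp (-δ * l1 (translate M x m - q)), fun u => CK * Real.exp (-δK * l1 (u - (N : ℤ) • y')),
      ((summable_exp_l1_translate M hδ q x).1).mul_left B, (summable_exp_shift' hδK ((N : ℤ) • y')).mul_left CK,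
      fun m => by positivity, fun u => by positivity, fun m u => ?_⟩
    rw [abs_mul, mul_comm]
    exact mul_le_mul (abs_le_row_of_biLoc (hT κ u) le_rfl hδ.le _ _ a c) (hK _ _ _ _) (abs_nonneg _) (by positivity)
  simp only [dper_apply, vertexOfK_apply]
  rw [Summable.tsum_finsetSum (fun κ _ => ?_)]
  · refine Finset.sum_congr rfl fun κ _ => ?_
    rw [tsum_comm_of_prodBound (hPB κ)]
    refine tsum_congr fun u => ?_
    rw [tsum_mul_left]
  · obtain ⟨h0, -, -⟩ := (hPB κ).summable
    exact h0.prod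

/-- [folklore] `dper M (vertexOfM K N G ν y′) = vertexOfM K N (dper M ∘ G) ν y′` for a coarse table family localised at ONE COMMON point `q`. -/
theorem dper_vertexOfM_of_biLocAt {G : Fin (d + 1) → Site (d + 1) → MKer (d + 1) (Fib d)} {q : Site (d + 1)} {B δ : ℝ} (hK : Decays K CK δK)
    (hδK : 0 < δK) (hG : ∀ ρ w, BiLoc (G ρ w) q q B δ) (hδ : 0 < δ) (ν : Fin (d + 1)) (y' : Site (d + 1)) :
    dper M (vertexOfM K N G ν y') = vertexOfM K N (fun ρ w => dper M (G ρ w)) ν y' := by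
  have hCK : 0 ≤ CK := hK.nonneg (Sum.inl 0)
  have hB : 0 ≤ B := (hG 0 0).nonneg (Sum.inl 0)
  have hN : 1 ≤ N := Nat.one_le_iff_ne_zero.mpr (NeZero.ne N)
  funext x z a c
  have e : ∀ (F : Fin (d + 1) → Site (d + 1) → MKer (d + 1) (Fib d)) (x z : Site (d + 1)),
      vertexOfM K N F ν y' x z a c = ∑ ρ, ∑' w, K ((N : ℤ) • w) ((N : ℤ) • y') (Sum.inr ρ) (Sum.inr ν) * F ρ w x z a c :=
    fun F x z => by simp only [vertexOfM, cwsum_apply, colM]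
  have hPB : ∀ ρ : Fin (d + 1), ProdBound fun m w => K ((N : ℤ) • w) ((N : ℤ) • y') (Sum.inr ρ) (Sum.inr ν) * G ρ w (translate M x m) (translate M z m) a c := by
    intro ρ
    refine ⟨fun m => B * Real.exp (-δ * l1 (translate M x m - q)), fun w => CK * Real.exp (-δK * l1 ((N : ℤ) • w - (N : ℤ) • y')),
      ((summable_exp_l1_translate M hδ q x).1).mul_left B, (summable_exp_l1_nsmul_sub (N := N) hN hδK ((N : ℤ) • y')).mul_left CK,
      fun m => by positivity, fun w => by positivity, fun m w => ?_⟩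
    rw [abs_mul, mul_comm]
    exact mul_le_mul (abs_le_row_of_biLoc (hG ρ w) le_rfl hδ.le _ _ a c) (hK _ _ _ _) (abs_nonneg _) (by positivity)
  simp only [dper_apply, e]
  rw [Summable.tsum_finsetSum (fun ρ _ => ?_)]
  · refine Finset.sum_congr rfl fun ρ _ => ?_
    rw [tsum_comm_of_prodBound (hPB ρ)]
    refine tsum_congr fun w => ?_
    rw [tsum_mul_left]
  · obtain ⟨h0, -, -⟩ := (hPB ρ).summable
    exact h0.prod

end Fubini

/-! ## §5 A vertex at a period-translated bond is the vertex at the bond over the index-shifted family (`K` fine-period invariant; pure re-indexing) -/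

section Translate

variable {M' : Fin (d + 1) → ℕ} {K : MKer (d + 1) (Fib d)}

omit [∀ μ, NeZero (M μ)] [NeZero N] in
/-- [folklore] the field column at the bond `N•(y′ + M′∘n)` is the column at `N•y′` read at the back-shifted fine index. -/
theorem colH_translate_per (hM : ∀ i, M i = N * M' i)
    (hKinv : ∀ (m x z : Site (d + 1)) (a b : Fib d), K (translate M x m) (translate M z m) a b = K x z a b)
    (ν κ : Fin (d + 1)) (y' n u : Site (d + 1)) :
    K u ((N : ℤ) • translate M' y' n) (Sum.inl κ) (Sum.inr ν) = K (translate M u (-n)) ((N : ℤ) • y') (Sum.inl κ) (Sum.inr ν) := by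
  have hu : translate M (translate M u (-n)) n = u := by
    rw [B4Reflection242.translate_translate, neg_add_cancel, CombHId2Product.translate_zero_right]
  rw [CombHId1Letters.nsmul_translate hM, ← hKinv n (translate M u (-n)) ((N : ℤ) • y'), hu]

omit [∀ μ, NeZero (M μ)] [NeZero N] in
/-- [folklore] the multiplier column at the bond `N•(y′ + M′∘n)` is the column at `N•y′` read at the back-shifted coarse index. -/
theorem colM_translate_per (hM : ∀ i, M i = N * M' i)
    (hKinv : ∀ (m x z : Site (d + 1)) (a b : Fib d), K (translate M x m) (translate M z m) a b = K x z a b)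
    (ν ρ : Fin (d + 1)) (y' n w : Site (d + 1)) :
    K ((N : ℤ) • w) ((N : ℤ) • translate M' y' n) (Sum.inr ρ) (Sum.inr ν)
      = K ((N : ℤ) • translate M' w (-n)) ((N : ℤ) • y') (Sum.inr ρ) (Sum.inr ν) := by
  have hw : translate M ((N : ℤ) • translate M' w (-n)) n = (N : ℤ) • w := by
    rw [CombHId1Letters.nsmul_translate hM, B4Reflection242.translate_translate, neg_add_cancel, CombHId2Product.translate_zero_right]
  rw [CombHId1Letters.nsmul_translate hM y', ← hKinv n ((N : ℤ) • translate M' w (-n)) ((N : ℤ) • y'), hw]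

omit [∀ μ, NeZero (M μ)] [NeZero N] in
/-- [folklore] **THE FIELD-COLUMN VERTEX AT A PERIOD-TRANSLATED BOND** is the vertex at the bond over the index-shifted table family:
`vertexOfK K N F ν (y′ + M′∘n) = vertexOfK K N (κ u ↦ F κ (u + M∘n)) ν y′` (re-index `u ↦ u + M∘n`). -/
theorem vertexOfK_translate_per (hM : ∀ i, M i = N * M' i)
    (hKinv : ∀ (m x z : Site (d + 1)) (a b : Fib d), K (translate M x m) (translate M z m) a b = K x z a b)
    (F : Fin (d + 1) → Site (d + 1) → MKer (d + 1) (Fib d)) (ν : Fin (d + 1)) (y' n : Site (d + 1)) :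
    vertexOfK K N F ν (translate M' y' n) = vertexOfK K N (fun κ u => F κ (translate M u n)) ν y' := by
  funext x z a c
  simp only [vertexOfK_apply]
  refine Finset.sum_congr rfl fun κ _ => ?_
  simp only [colH_translate_per M hM hKinv]
  rw [← (Equiv.addRight (fun i => (M i : ℤ) * n i)).tsum_eq (fun u => K (translate M u (-n)) ((N : ℤ) • y') (Sum.inl κ) (Sum.inr ν) * F κ u x z a c)]
  refine tsum_congr fun u => ?_
  have e1 : (Equiv.addRight (fun i => (M i : ℤ) * n i)) u = translate M u n := by
    rw [Equiv.coe_addRight, FP.KernelPeriodisationFib.translate_eq_add]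
  rw [e1, B4Reflection242.translate_translate, add_neg_cancel, CombHId2Product.translate_zero_right]

omit [∀ μ, NeZero (M μ)] in
/-- [folklore] **THE MULTIPLIER-COLUMN VERTEX AT A PERIOD-TRANSLATED BOND**: `vertexOfM K N G ν (y′ + M′∘n) = vertexOfM K N (ρ w ↦ G ρ (w + M′∘n)) ν y′`. -/
theorem vertexOfM_translate_per (hM : ∀ i, M i = N * M' i)
    (hKinv : ∀ (m x z : Site (d + 1)) (a b : Fib d), K (translate M x m) (translate M z m) a b = K x z a b)
    (G : Fin (d + 1) → Site (d + 1) → MKer (d + 1) (Fib d)) (ν : Fin (d + 1)) (y' n : Site (d + 1)) :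
    vertexOfM K N G ν (translate M' y' n) = vertexOfM K N (fun ρ w => G ρ (translate M' w n)) ν y' := by
  funext x z a c
  have e : ∀ (F : Fin (d + 1) → Site (d + 1) → MKer (d + 1) (Fib d)) (yy : Site (d + 1)),
      vertexOfM K N F ν yy x z a c = ∑ ρ, ∑' w, K ((N : ℤ) • w) ((N : ℤ) • yy) (Sum.inr ρ) (Sum.inr ν) * F ρ w x z a c :=
    fun F yy => by simp only [vertexOfM, cwsum_apply, colM]
  rw [e, e]
  refine Finset.sum_congr rfl fun ρ _ => ?_
  simp only [colM_translate_per M hM hKinv]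
  rw [← (Equiv.addRight (fun i => (M' i : ℤ) * n i)).tsum_eq (fun w => K ((N : ℤ) • translate M' w (-n)) ((N : ℤ) • y') (Sum.inr ρ) (Sum.inr ν) * G ρ w x z a c)]
  refine tsum_congr fun w => ?_
  have e1 : (Equiv.addRight (fun i => (M' i : ℤ) * n i)) w = translate M' w n := by
    rw [Equiv.coe_addRight, FP.KernelPeriodisationFib.translate_eq_add]
  rw [e1, B4Reflection242.translate_translate, add_neg_cancel, CombHId2Product.translate_zero_right]

end Translate

end Summit.QuantumFields.BalabanUV.Beta.CombHId2W2Exchange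

end
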